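import Summits.CriticalPhenomena.SAWScalingLimit.Theorems.SAWTotalPositivityBoundaryTP2Defs
import Summits.CriticalPhenomena.SAWScalingLimit.Theorems.SAWTotalPositivityBoundaryTP2Kernel
import Summits.CriticalPhenomena.SAWScalingLimit.Theorems.EdgeOfPositivity.Negative.EdgeOfPositivityRectDomain
import Literature.Probability.Percolation.PlanarDuality
import HarnessLib

/-!
# Crux `BoundaryTP2` (stmt-CriticalPhenomena-7115), line `Sketch`: stub `stub_rect_onePerSide`

Hypothesis (i) of the crux (interlacing) holds STRUCTURALLY on every box `{0..a} × {0..b}` for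
every quadruple of sites with one point per side in cyclic order (`p₁` on the left side `x = 0`,
`p₂` on the bottom side `y = 0`, `p₃` on the right side `x = a`, `p₄` on the top side `y = b`):
a self-avoiding path `p₁ → p₃` of the box graph is a left-right crossing of the rectangle
`[0, a] × [0, b]` and a self-avoiding path `p₂ → p₄` a bottom-top crossing, so they share a vertex
by the discrete Jordan lemma `Literature.Probability.Percolation.exists_mem_support_of_crossing`
("a horizontal and a vertical crossing of a rectangle meet").
-/

noncomputable section

namespace Summit.CriticalPhenomena.SAWScalingLimit.Theorems.BoundaryTP2

open Literature.Probability.LatticeModels Literature.Probability.RandomPlanarGeometry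
open Summit.CriticalPhenomena.SAWScalingLimit.Theorems.EdgeOfPositivity.Negative

/-- Every vertex of a walk of the box graph `R_1 = discreteDomainGraph (rectDomain a b) 1` between
two sites of the box is a site of the box (the end vertex by hypothesis, every other vertex as the
tail of an edge of `R_1`). [folklore] -/
private theorem mem_rectSites_of_mem_support {a b : ℕ} {u v : Site 2}
    (p : (discreteDomainGraph (rectDomain a b) 1).Walk u v) (hu : u ∈ rectSites a b)
    (hv : v ∈ rectSites a b) {z : Site 2} (hz : z ∈ p.support) : z ∈ rectSites a b := by
  induction p with
  | nil =>
    rw [SimpleGraph.Walk.support_nil, List.mem_singleton] at hz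
    exact hz ▸ hv
  | cons h q ih =>
    rw [SimpleGraph.Walk.support_cons, List.mem_cons] at hz
    rcases hz with rfl | hz
    · exact hu
    · exact ih (adj_rect_iff.1 h).2.2 hv hz

/-- On the box `R = discreteDomainGraph (rectDomain a b) 1` (sites `{0..a}×{0..b}`), four sites of
the box with `p₁` on the left side, `p₂` on the bottom side, `p₃` on the right side and `p₄` on the
top side are interlaced: every self-avoiding path `p₁ → p₃` (a left-right crossing of the rectangle
`[0,a]×[0,b]`, once mapped to `ℤ²` by `Walk.mapLe`) meets every self-avoiding path `p₂ → p₄`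
(a bottom-top crossing), by the discrete Jordan lemma `exists_mem_support_of_crossing`.
[folklore] -/
theorem stub_rect_onePerSide (a b : ℕ) {p₁ p₂ p₃ p₄ : Site 2}
    (hp₁ : p₁ ∈ rectSites a b) (hp₂ : p₂ ∈ rectSites a b) (hp₃ : p₃ ∈ rectSites a b)
    (hp₄ : p₄ ∈ rectSites a b) (h₁ : p₁ 0 = 0) (h₂ : p₂ 1 = 0) (h₃ : p₃ 0 = a) (h₄ : p₄ 1 = b) :
    Interlaced (discreteDomainGraph (rectDomain a b) 1) p₁ p₂ p₃ p₄ := by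
  intro P Q
  have hle : discreteDomainGraph (rectDomain a b) 1 ≤ zdGraph 2 :=
    discreteDomainGraph_le_zdGraph (rectDomain a b) 1
  -- both supports stay in the rectangle `[0, a] × [0, b]`
  have hP : ∀ z ∈ (P.1.mapLe hle).support,
      (0 : ℤ) ≤ z 0 ∧ z 0 ≤ (a : ℤ) ∧ (0 : ℤ) ≤ z 1 ∧ z 1 ≤ (b : ℤ) := by
    intro z hz
    rw [SimpleGraph.Walk.support_mapLe_eq_support] at hz
    exact and_assoc.1 (mem_rectSites_iff.1 (mem_rectSites_of_mem_support P.1 hp₁ hp₃ hz))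
  have hQ : ∀ z ∈ (Q.1.mapLe hle).support,
      (0 : ℤ) ≤ z 0 ∧ z 0 ≤ (a : ℤ) ∧ (0 : ℤ) ≤ z 1 ∧ z 1 ≤ (b : ℤ) := by
    intro z hz
    rw [SimpleGraph.Walk.support_mapLe_eq_support] at hz
    exact and_assoc.1 (mem_rectSites_iff.1 (mem_rectSites_of_mem_support Q.1 hp₂ hp₄ hz))
  -- a left-right crossing meets a bottom-top crossing
  obtain ⟨z, hzP, hzQ⟩ := Literature.Probability.Percolation.exists_mem_support_of_crossing
    (P.1.mapLe hle) (Q.1.mapLe hle) hP hQ h₁ h₃ h₂ h₄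
  rw [SimpleGraph.Walk.support_mapLe_eq_support] at hzP hzQ
  exact ⟨z, hzP, hzQ⟩

end Summit.CriticalPhenomena.SAWScalingLimit.Theorems.BoundaryTP2
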